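import Literature.AlgebraicGeometry.HodgeTheory.FermatDiagonalAction
import HarnessLib

/-!
# The linear substitution of the cone map `X²ˢₘ × lines → X^{2s+2}ₘ`: `z = (u_{2s+2}, ρ u_{2s+2}, u₀, …, u_{2s+1})`

Family `hodge`, layer `Literature/AlgebraicGeometry/HodgeTheory`. DEFINITIONS (small, with their
unfolding lemmas) for the cone spans of Aoki 1987, Thm. 1-4 (i) (`r = 0`; the completed cones joining a
point `v_ρ = (1 : ρ : 0 : … : 0)` of `X⁰ₘ = {z₀ᵐ + z₁ᵐ = 0} ∩ {z₂ = ⋯ = 0}` to the sub-Fermat variety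
`X2 = {z₀ = z₁ = 0} ≅ X²ˢₘ` of `X^{2s+2}ₘ`; Shioda 1979, Thm. I): the linear map
`λ_ρ : ℙ^{2s+2} → ℙ^{2s+3}`, `[u₀ : ⋯ : u_{2s+1} : u_{2s+2}] ↦ [u_{2s+2} : ρ u_{2s+2} : u₀ : ⋯ : u_{2s+1}]`
through which the blow-up `Bl_{vertex} ℙ^{2s+2} → ℙ^{2s+2}` of the vertex `(0 : … : 0 : 1)` maps the
host `X²ˢₘ ×_{ℙ^{2s+1}} Bl_{vertex} ℙ^{2s+2}` onto the cone with vertex `v_ρ`: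

* `FermatCone.subst s ρ` — the substitution `zⱼ ↦ λ_ρ`-coordinates (linear forms in the `u`'s);
* `FermatCone.twist s c` — the diagonal symmetry `(c_{2s+2}, c_{2s+2}, c₀, …, c_{2s+1})` of `ℙ^{2s+3}`
  under which `λ_ρ` is equivariant for `[u] ↦ [c • u]`;
* `FermatCone.xPart s a` — the last `2s + 2` coordinates of `a ∈ μₘ^{2s+4}` (acting on `X2 ≅ X²ˢₘ`);
* unfolding lemmas, homogeneity, `FermatCone.aeval_subst_fermatPolynomial` — **`Σⱼ λ_ρ,ⱼ(u)ᵐ = Σ_{i ≤ 2s+1} uᵢᵐ`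
  for `ρᵐ = -1`** (the cone lies on `X^{2s+2}ₘ`), `FermatCone.aeval_diagonalSubst_subst` (equivariance).

## References

* [Aoki1987] N. Aoki, Some new algebraic cycles on Fermat varieties, J. Math. Soc. Japan 39 (1987),
  Thm. 1-4 (i) p. 388.
* [Shioda1979HodgeFermat] T. Shioda, The Hodge conjecture for Fermat varieties, Math. Ann. 245
  (1979), §1 and Thm. I.
-/

noncomputable section

open MvPolynomial Literature.AlgebraicGeometry.Motives

namespace Literature.AlgebraicGeometry.HodgeTheory

namespace FermatCone

variable (s : ℕ)

/-- **The substitution of the cone map**: `z₀ ↦ u_{2s+2}`, `z₁ ↦ ρ u_{2s+2}`, `z_{i+2} ↦ uᵢ`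
(`i ≤ 2s+1`), linear forms in `u₀, …, u_{2s+2}` indexed by the `2s + 4` coordinates of `ℙ^{2s+3}`.
[cite: Aoki1987, Thm. 1-4 (i) p. 388] -/
def subst (ρ : ℂ) (j : Fin (2 * (s + 1) + 2)) : MvPolynomial (Fin (2 * s + 1 + 1 + 1)) ℂ :=
  if j.val = 0 then X (Fin.last _)
  else if j.val = 1 then C ρ * X (Fin.last _)
  else X ⟨j.val - 2, by omega⟩

/-- `subst s ρ 0 = u_{2s+2}`. [folklore] -/
theorem subst_apply_of_val_eq_zero (ρ : ℂ) {j : Fin (2 * (s + 1) + 2)} (hj : j.val = 0) :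
    subst s ρ j = X (Fin.last _) := by
  simp [subst, hj]

/-- `subst s ρ 1 = ρ u_{2s+2}`. [folklore] -/
theorem subst_apply_of_val_eq_one (ρ : ℂ) {j : Fin (2 * (s + 1) + 2)} (hj : j.val = 1) :
    subst s ρ j = C ρ * X (Fin.last _) := by
  simp [subst, hj]

/-- `subst s ρ (i + 2) = uᵢ`. [folklore] -/
theorem subst_apply_of_two_le (ρ : ℂ) {j : Fin (2 * (s + 1) + 2)} (hj : 2 ≤ j.val) :
    subst s ρ j = X ⟨j.val - 2, by omega⟩ := by
  have h0 : j.val ≠ 0 := by omega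
  have h1 : j.val ≠ 1 := by omega
  simp [subst, h0, h1]

/-- The forms `subst s ρ j` are linear. [folklore] -/
theorem isHomogeneous_subst (ρ : ℂ) (j : Fin (2 * (s + 1) + 2)) : (subst s ρ j).IsHomogeneous 1 := by
  unfold subst
  split_ifs
  · exact isHomogeneous_X ℂ _
  · exact (isHomogeneous_X ℂ _).C_mul ρ
  · exact isHomogeneous_X ℂ _

/-- Every variable `u_l` is one of the forms `subst s ρ j`. [folklore] -/
theorem exists_subst_eq_X (ρ : ℂ) (l : Fin (2 * s + 1 + 1 + 1)) : ∃ j, subst s ρ j = X l := by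
  by_cases hl : l.val = 2 * s + 1 + 1
  · refine ⟨⟨0, by omega⟩, ?_⟩
    rw [subst_apply_of_val_eq_zero s ρ rfl]
    congr 1
    exact Fin.ext (by simp [hl])
  · have hl' : l.val < 2 * s + 1 + 1 := by have := l.isLt; omega
    refine ⟨⟨l.val + 2, by omega⟩, ?_⟩
    rw [subst_apply_of_two_le s ρ (by simp)]
    congr 1

/-- **The cone lies on the Fermat variety**: for `ρᵐ = -1`,
`Σ_{j ≤ 2s+3} (subst s ρ j)ᵐ = u_{2s+2}ᵐ (1 + ρᵐ) + Σ_{i ≤ 2s+1} uᵢᵐ = Σ_{i ≤ 2s+1} uᵢᵐ`, i.e. the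
Fermat form of `X^{2s+2}ₘ` pulls back to that of `X²ˢₘ` in the first `2s + 2` variables.
[cite: Aoki1987, Thm. 1-4 (i) p. 388] [cite: Shioda1979HodgeFermat, §1] -/
theorem aeval_subst_fermatPolynomial {m : ℕ} {ρ : ℂ} (hρ : ρ ^ m = -1) :
    aeval (subst s ρ) (fermatPolynomial ℂ (2 * (s + 1)) m) =
      rename Fin.castSucc (fermatPolynomial ℂ (2 * s) m) := by
  simp only [fermatPolynomial, map_sum, map_pow, aeval_X, rename_X]
  -- split off the slots `0` and `1`
  rw [Fin.sum_univ_succ, Fin.sum_univ_succ]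
  have h0 : subst s ρ 0 = X (Fin.last _) := subst_apply_of_val_eq_zero s ρ rfl
  have h1 : subst s ρ (Fin.succ 0) = C ρ * X (Fin.last _) := subst_apply_of_val_eq_one s ρ rfl
  rw [h0, h1, mul_pow, ← C_pow, hρ, C_neg, C_1, neg_one_mul, ← add_assoc, add_neg_cancel, zero_add]
  refine Fintype.sum_equiv (finCongr (show 2 * (s + 1) = 2 * s + 2 by ring)) _ _ fun i ↦ ?_
  have hi : 2 ≤ (i.succ.succ : Fin (2 * (s + 1) + 2)).val := by simp [Fin.val_succ]
  rw [subst_apply_of_two_le s ρ hi]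
  congr 2

/-- **The diagonal symmetry of `ℙ^{2s+3}` over `[u] ↦ [c • u]`**: `(c_{2s+2}, c_{2s+2}, c₀, …, c_{2s+1})`.
[cite: Shioda1979HodgeFermat, §1] -/
def twist (c : Fin (2 * s + 1 + 2) → ℂˣ) (j : Fin (2 * (s + 1) + 2)) : ℂˣ :=
  if j.val = 0 then c (Fin.last _)
  else if j.val = 1 then c (Fin.last _)
  else c ⟨j.val - 2, by omega⟩

/-- `twist s c 0 = c_{2s+2}`. [folklore] -/
theorem twist_apply_of_val_eq_zero (c : Fin (2 * s + 1 + 2) → ℂˣ) {j : Fin (2 * (s + 1) + 2)}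
    (hj : j.val = 0) : twist s c j = c (Fin.last _) := by
  simp [twist, hj]

/-- `twist s c 1 = c_{2s+2}`. [folklore] -/
theorem twist_apply_of_val_eq_one (c : Fin (2 * s + 1 + 2) → ℂˣ) {j : Fin (2 * (s + 1) + 2)}
    (hj : j.val = 1) : twist s c j = c (Fin.last _) := by
  simp [twist, hj]

/-- `twist s c (i + 2) = cᵢ`. [folklore] -/
theorem twist_apply_of_two_le (c : Fin (2 * s + 1 + 2) → ℂˣ) {j : Fin (2 * (s + 1) + 2)}
    (hj : 2 ≤ j.val) : twist s c j = c ⟨j.val - 2, by omega⟩ := by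
  have h0 : j.val ≠ 0 := by omega
  have h1 : j.val ≠ 1 := by omega
  simp [twist, h0, h1]

/-- **`λ_ρ` is equivariant**: `σ_c (subst s ρ j) = (twist s c)ⱼ · subst s ρ j`, i.e.
`λ_ρ(c • u) = twist(c) • λ_ρ(u)`. [cite: Shioda1979HodgeFermat, §1] -/
theorem aeval_diagonalSubst_subst (c : Fin (2 * s + 1 + 2) → ℂˣ) (ρ : ℂ) (j : Fin (2 * (s + 1) + 2)) :
    aeval (diagonalSubst c) (subst s ρ j) = C (twist s c j : ℂ) * subst s ρ j := by
  by_cases h0 : j.val = 0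
  · rw [subst_apply_of_val_eq_zero s ρ h0, twist_apply_of_val_eq_zero s c h0, aeval_X, diagonalSubst_apply]
  · by_cases h1 : j.val = 1
    · rw [subst_apply_of_val_eq_one s ρ h1, twist_apply_of_val_eq_one s c h1, map_mul, aeval_C, aeval_X,
        diagonalSubst_apply]
      simp only [MvPolynomial.algebraMap_eq]
      ring
    · have h2 : 2 ≤ j.val := by omega
      rw [subst_apply_of_two_le s ρ h2, twist_apply_of_two_le s c h2, aeval_X, diagonalSubst_apply]

/-- **The last `2s + 2` coordinates of a symmetry `a ∈ (ℂˣ)^{2s+4}` of `ℙ^{2s+3}`** (its action on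
`X2 = {z₀ = z₁ = 0} ≅ X²ˢₘ`). [cite: Shioda1979HodgeFermat, §1] -/
def xPart (a : Fin (2 * (s + 1) + 2) → ℂˣ) (k : Fin (2 * s + 2)) : ℂˣ :=
  a ⟨k.val + 2, by omega⟩

/-- `xPart s a k = a_{k+2}` (`rfl`). [folklore] -/
theorem xPart_apply (a : Fin (2 * (s + 1) + 2) → ℂˣ) (k : Fin (2 * s + 2)) :
    xPart s a k = a ⟨k.val + 2, by omega⟩ := rfl

/-- `xPart` of an element of `μₘ^{2s+4}` lies in `μₘ^{2s+2}`. [folklore] -/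
theorem xPart_mem_fermatGroup {m : ℕ} {a : Fin (2 * (s + 1) + 2) → ℂˣ} (ha : a ∈ fermatGroup (2 * (s + 1)) m) :
    xPart s a ∈ fermatGroup (2 * s) m :=
  mem_fermatGroup_iff.mpr fun _ ↦ mem_fermatGroup_iff.mp ha _

/-- `xPart (a⁻¹) = (xPart a)⁻¹`. [folklore] -/
theorem xPart_inv (a : Fin (2 * (s + 1) + 2) → ℂˣ) : xPart s a⁻¹ = (xPart s a)⁻¹ := rfl

/-- `xPart (a b) = xPart a · xPart b`. [folklore] -/
theorem xPart_mul (a b : Fin (2 * (s + 1) + 2) → ℂˣ) : xPart s (a * b) = xPart s a * xPart s b := rfl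

end FermatCone

end Literature.AlgebraicGeometry.HodgeTheory

end
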